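import Literature.Analysis.FluidPDE.MildSolutionProofs
import Literature.Analysis.FluidPDE.WholeSpaceIBP
import Mathlib.Analysis.SpecialFunctions.SmoothTransition
import Mathlib.Analysis.Calculus.Deriv.Slope
import HarnessLib

/-!
# A radial, radially non-increasing smooth cutoff at scale `R`

Analysis/FluidPDE support file (all results proved, no new definitions; used by the localised
similarity-enstrophy estimate of the crux `MustSqueeze`, route SqueezeCycle,
NavierStokesRegularity, where the sign of the Leray-drift flux `∫ ‖Ω‖² (y·∇φ) ≤ 0` requires a
cutoff that is non-increasing along rays). The cutoff is the explicit function
`y ↦ Real.smoothTransition (2 − ‖y‖² / R²)` (smooth since `‖·‖²` is): it is `C^∞`, takes values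
in `[0, 1]`, equals `1` on the closed ball of radius `R`, vanishes outside the ball of radius
`2R` (indeed outside radius `√2 R`), satisfies **`y·∇φ(y) ≤ 0`** everywhere, and obeys the
scaling bounds `‖∇φ‖ ≤ c/R`, `|Δφ| ≤ c/R²` with `c` independent of `R` (it is the rescaling
`φ₁(y/R)` of the unit cutoff). Standard (Evans, *PDE*, App. C.4; the ray-monotonicity is the
property used for local energy/enstrophy fluxes through shrinking balls).

## References

* L. C. Evans, *Partial Differential Equations*, 2nd ed., AMS 2010, App. C.4 (cutoff
  functions). [Evans2010]
-/

noncomputable section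

open MeasureTheory Set Function Filter InnerProductSpace Metric Real
open _root_.Topology
open scoped RealInnerProductSpace Laplacian ContDiff

namespace Literature.Analysis.FluidPDE

variable {E : Type*} [NormedAddCommGroup E] [InnerProductSpace ℝ E]

/-- The scale-`R` cutoff is the rescaling of the unit one:
`smoothTransition (2 − ‖y‖²/R²) = smoothTransition (2 − ‖R⁻¹ • y‖²)`. [folklore] -/
theorem smoothTransition_cutoff_eq_comp_smul {R : ℝ} (hR : 0 < R) :
    (fun y : E => smoothTransition (2 - ‖y‖ ^ 2 / R ^ 2)) =
      fun y : E => (fun z : E => smoothTransition (2 - ‖z‖ ^ 2)) (R⁻¹ • y) := by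
  funext y
  simp only [norm_smul, norm_inv, Real.norm_of_nonneg hR.le, mul_pow, inv_pow]
  rw [div_eq_inv_mul]

/-- The unit cutoff `z ↦ smoothTransition (2 − ‖z‖²)` is smooth. [folklore] -/
theorem contDiff_smoothTransition_unitCutoff {n : ℕ∞} :
    ContDiff ℝ n fun z : E => smoothTransition (2 - ‖z‖ ^ 2) :=
  Real.smoothTransition.contDiff.comp (contDiff_const.sub (contDiff_norm_sq ℝ))

/-- **Smoothness** of the scale-`R` cutoff. [folklore] -/
theorem contDiff_smoothTransition_cutoff {n : ℕ∞} (R : ℝ) :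
    ContDiff ℝ n fun y : E => smoothTransition (2 - ‖y‖ ^ 2 / R ^ 2) :=
  Real.smoothTransition.contDiff.comp (contDiff_const.sub ((contDiff_norm_sq ℝ).div_const _))

omit [InnerProductSpace ℝ E] in
/-- **Values in `[0, 1]`**: nonnegativity. [folklore] -/
theorem smoothTransition_cutoff_nonneg (R : ℝ) (y : E) :
    0 ≤ smoothTransition (2 - ‖y‖ ^ 2 / R ^ 2) :=
  Real.smoothTransition.nonneg _

omit [InnerProductSpace ℝ E] in
/-- **Values in `[0, 1]`**: the cutoff is at most `1`. [folklore] -/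
theorem smoothTransition_cutoff_le_one (R : ℝ) (y : E) :
    smoothTransition (2 - ‖y‖ ^ 2 / R ^ 2) ≤ 1 :=
  Real.smoothTransition.le_one _

omit [InnerProductSpace ℝ E] in
/-- **Plateau**: the cutoff equals `1` on the closed ball of radius `R`. [folklore] -/
theorem smoothTransition_cutoff_eq_one {R : ℝ} (hR : 0 < R) {y : E} (hy : ‖y‖ ≤ R) :
    smoothTransition (2 - ‖y‖ ^ 2 / R ^ 2) = 1 := by
  apply Real.smoothTransition.one_of_one_le
  have h1 : ‖y‖ ^ 2 / R ^ 2 ≤ 1 := by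
    rw [div_le_one (by positivity)]
    exact pow_le_pow_left₀ (norm_nonneg _) hy 2
  linarith

omit [InnerProductSpace ℝ E] in
/-- **Support**: the cutoff vanishes where `2R² ≤ ‖y‖²`, in particular for `2R ≤ ‖y‖`. [folklore] -/
theorem smoothTransition_cutoff_eq_zero {R : ℝ} (hR : 0 < R) {y : E} (hy : 2 * R ≤ ‖y‖) :
    smoothTransition (2 - ‖y‖ ^ 2 / R ^ 2) = 0 := by
  apply Real.smoothTransition.zero_of_nonpos
  have h4 : (2 * R) ^ 2 ≤ ‖y‖ ^ 2 := pow_le_pow_left₀ (by positivity) hy 2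
  have h2 : 2 ≤ ‖y‖ ^ 2 / R ^ 2 := by
    rw [le_div_iff₀ (by positivity)]
    nlinarith
  linarith

/-- **Compact support** (inside the closed ball of radius `2R`). [folklore] -/
theorem hasCompactSupport_smoothTransition_cutoff [FiniteDimensional ℝ E] {R : ℝ} (hR : 0 < R) :
    HasCompactSupport fun y : E => smoothTransition (2 - ‖y‖ ^ 2 / R ^ 2) := by
  haveI : ProperSpace E := FiniteDimensional.proper ℝ E
  refine HasCompactSupport.of_support_subset_isCompact (isCompact_closedBall (0 : E) (2 * R)) ?_
  intro y hy
  rw [mem_closedBall, dist_zero_right]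
  by_contra h
  exact hy (smoothTransition_cutoff_eq_zero hR (not_le.1 h).le)

omit [InnerProductSpace ℝ E] in
/-- The cutoff vanishes off the closed ball of radius `2R` (pointwise form of the support
statement). [folklore] -/
theorem smoothTransition_cutoff_eq_zero_of_notMem {R : ℝ} (hR : 0 < R) {y : E}
    (hy : y ∉ closedBall (0 : E) (2 * R)) : smoothTransition (2 - ‖y‖ ^ 2 / R ^ 2) = 0 := by
  rw [mem_closedBall, dist_zero_right, not_le] at hy
  exact smoothTransition_cutoff_eq_zero hR hy.le

/-- **Ray monotonicity: `y·∇φ(y) ≤ 0`.** Along the ray `c ↦ c y` the argument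
`2 − c²‖y‖²/R²` decreases and `smoothTransition` is monotone, so the directional derivative of
the cutoff in the direction `y` at `y` is `ψ'(…)·(−2‖y‖²/R²) ≤ 0`. [folklore] -/
theorem fderiv_smoothTransition_cutoff_self_nonpos (R : ℝ) (y : E) :
    fderiv ℝ (fun z : E => smoothTransition (2 - ‖z‖ ^ 2 / R ^ 2)) y y ≤ 0 := by
  set φ : E → ℝ := fun z => smoothTransition (2 - ‖z‖ ^ 2 / R ^ 2) with hφ
  have hφd : Differentiable ℝ φ := (contDiff_smoothTransition_cutoff (n := 1) R).differentiable
    one_ne_zero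
  -- the restriction to the ray `c ↦ c • y`
  have hline : HasDerivAt (fun c : ℝ => φ (c • y)) (fderiv ℝ φ y y) 1 := by
    have h := (hφd ((1 : ℝ) • y)).hasFDerivAt.comp_hasDerivAt (1 : ℝ)
      ((hasDerivAt_id (1 : ℝ)).smul_const y)
    simp only [one_smul, id] at h
    exact h
  -- the same restriction as a composition with `smoothTransition`
  have hq : HasDerivAt (fun c : ℝ => 2 - c ^ 2 * (‖y‖ ^ 2 / R ^ 2))
      (-(2 * (1 : ℝ) ^ 1 * (‖y‖ ^ 2 / R ^ 2))) 1 := by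
    have := ((hasDerivAt_pow 2 (1 : ℝ)).mul_const (‖y‖ ^ 2 / R ^ 2)).const_sub 2
    simpa using this
  have hψ : HasDerivAt smoothTransition (deriv smoothTransition (2 - (1 : ℝ) ^ 2 * (‖y‖ ^ 2 / R ^ 2)))
      (2 - (1 : ℝ) ^ 2 * (‖y‖ ^ 2 / R ^ 2)) :=
    ((Real.smoothTransition.contDiff (n := 1)).differentiable one_ne_zero _).hasDerivAt
  have hcomp := hψ.comp (1 : ℝ) hq
  have heq : (fun c : ℝ => φ (c • y)) = smoothTransition ∘ fun c : ℝ => 2 - c ^ 2 * (‖y‖ ^ 2 / R ^ 2) := by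
    funext c
    simp only [hφ, Function.comp_apply, norm_smul, Real.norm_eq_abs, mul_pow, sq_abs]
    ring_nf
  rw [heq] at hline
  have hval := hline.unique hcomp
  rw [hval]
  have hψ' : 0 ≤ deriv smoothTransition (2 - (1 : ℝ) ^ 2 * (‖y‖ ^ 2 / R ^ 2)) :=
    Real.smoothTransition.monotone.deriv_nonneg
  have hnn : 0 ≤ ‖y‖ ^ 2 / R ^ 2 := by positivity
  nlinarith

/-- **Gradient bound `‖∇φ‖ ≤ c/R`** with `c` independent of `R` (scaling of the unit cutoff,
whose derivative is continuous with compact support). [folklore] -/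
theorem exists_norm_fderiv_smoothTransition_cutoff_le [FiniteDimensional ℝ E] :
    ∃ c : ℝ, 0 ≤ c ∧ ∀ R : ℝ, 0 < R → ∀ y : E,
      ‖fderiv ℝ (fun z : E => smoothTransition (2 - ‖z‖ ^ 2 / R ^ 2)) y‖ ≤ c / R := by
  haveI : ProperSpace E := FiniteDimensional.proper ℝ E
  have h1 : HasCompactSupport fun z : E => smoothTransition (2 - ‖z‖ ^ 2) := by
    have := hasCompactSupport_smoothTransition_cutoff (E := E) one_pos
    simpa using this
  obtain ⟨c, hc⟩ := ((contDiff_smoothTransition_unitCutoff (E := E) (n := 1)).continuous_fderiv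
    one_ne_zero).bounded_above_of_compact_support (h1.fderiv (𝕜 := ℝ))
  refine ⟨max c 0, le_max_right _ _, fun R hR y => ?_⟩
  rw [smoothTransition_cutoff_eq_comp_smul hR,
    fderiv_comp_smul (𝕜 := ℝ) (f := fun z : E => smoothTransition (2 - ‖z‖ ^ 2)) (x := y) R⁻¹,
    norm_smul, norm_inv, Real.norm_of_nonneg hR.le, div_eq_inv_mul]
  gcongr
  exact (hc _).trans (le_max_left _ _)

/-- **Laplacian bound `|Δφ| ≤ c/R²`** with `c` independent of `R` (scaling of the unit cutoff,
whose Laplacian is continuous with compact support). [folklore] -/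
theorem exists_abs_laplacian_smoothTransition_cutoff_le [FiniteDimensional ℝ E] :
    ∃ c : ℝ, 0 ≤ c ∧ ∀ R : ℝ, 0 < R → ∀ y : E,
      |(Δ (fun z : E => smoothTransition (2 - ‖z‖ ^ 2 / R ^ 2))) y| ≤ c / R ^ 2 := by
  haveI : ProperSpace E := FiniteDimensional.proper ℝ E
  have h2 : ContDiff ℝ 2 fun z : E => smoothTransition (2 - ‖z‖ ^ 2) :=
    contDiff_smoothTransition_unitCutoff (n := 2)
  have h1 : HasCompactSupport fun z : E => smoothTransition (2 - ‖z‖ ^ 2) := by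
    have := hasCompactSupport_smoothTransition_cutoff (E := E) one_pos
    simpa using this
  have hΔc : Continuous (Δ fun z : E => smoothTransition (2 - ‖z‖ ^ 2)) := continuous_laplacian h2
  have hΔs : HasCompactSupport (Δ fun z : E => smoothTransition (2 - ‖z‖ ^ 2)) :=
    HasCompactSupport.intro h1 fun y hy => laplacian_eq_zero_of_notMem_tsupport hy
  obtain ⟨c, hc⟩ := hΔc.bounded_above_of_compact_support hΔs
  refine ⟨max c 0, le_max_right _ _, fun R hR y => ?_⟩
  rw [smoothTransition_cutoff_eq_comp_smul hR, laplacian_comp_smul h2 R⁻¹ y, smul_eq_mul, abs_mul,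
    abs_of_nonneg (by positivity : (0 : ℝ) ≤ R⁻¹ ^ 2), inv_pow, div_eq_inv_mul]
  gcongr
  have h := hc (R⁻¹ • y)
  rw [Real.norm_eq_abs] at h
  exact h.trans (le_max_left _ _)

end Literature.Analysis.FluidPDE

end
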